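import Literature.Topology.FourManifolds.CappellShanesonClassGroupFourteen
import Literature.NumberTheory.NumberFields.CubicFieldConductor
import HarnessLib

/-!
# `𝓞 K = ℤ[θ]` for the Cappell–Shaneson cubics with `7² ∥ Δ(fₙ)`: Eisenstein at `7`

Serves the named fact
`Literature.Topology.FourManifolds.kimYamada2023_nonempty_diffeomorph_sphere_four_of_trace_mem_Icc`
(`CappellShaneson.lean`; M. H. Kim, S. Yamada, Kyungpook Math. J. 63 (2023) 373–411 =
arXiv:1707.03860, Cor. C) through Theorem B (`GompfConjectureForTrace n`) for the traces
`n ≡ 6 (mod 7)`, `n ≢ 27 (mod 49)` in `[13, 69]`, i.e. `n = 13, 20, 34, 41, 48, 55, 62, 69`. For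
these `fₙ = x³ - nx² + (n-1)x - 1 ≡ (x - 2)³ (mod 7)` and `7² ∣ Δ(fₙ) = n(n-2)(n-3)(n-5) - 23`, so the
square-factor criterion of `CappellShanesonClassNumberTwo.lean` (`…_of_sq`) does not apply; but
`fₙ(x + 2) = x³ + (6-n)x² + (11-3n)x + (5-2n)` is `7`-Eisenstein exactly when `n ≢ 27 (mod 49)`
(KY Prop. 4.10/4.11: `ℤ[Θ₄₉ₖ₊₂₇]` is NOT integrally closed), and then `ℤ[θ]` is still the maximal
order. PROVED here, for a general trace `a`:

* `indexDet_dvd_pow_of_smul_mem`: if `m · 𝓞 K ⊆ ℤ[θ]` then the index determinant of `1, θ, θ²`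
  divides `m³` (determinants of `ℤ`-linear maps);
* `isUnit_indexDet_csPB_of_eisenstein`: if `Δ(f_a) = 49 m` with `7 ∤ m`, `m` squarefree (a
  bounded check), and `f_a(x+2)` is `7`-Eisenstein, then the index determinant is a unit:
  `Δ · 𝓞 K ⊆ ℤ[θ]` (Mathlib `Algebra.discr_mul_isIntegral_mem_adjoin`), the Eisenstein lemma
  removes `7²` (`MonicCubic.mem_adjoin_of_eisenstein`, Mathlib
  `mem_adjoin_of_smul_prime_pow_smul_of_minpoly_isEisensteinAt`), so `m · 𝓞 K ⊆ ℤ[θ]`, the index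
  divides `m³` and its square divides `49 m`;
* the Dedekind–Kummer consequences under the hypothesis "index determinant a unit"
  (`…_of_isUnit`: `discr_eq_csDisc`, `adjoin_thetaInt_eq_top`, `exists_factor_of_mem_primesOver`,
  `eq_span_of_no_root`, `eq_span_pair_of_unique_root`, `eq_span_pair_of_split`,
  `eq_span_pair_of_linear_mul_quadratic`, `exists_ringEquiv_adjoinRoot`), with the proofs of the
  `_of_sq` versions (`CappellShanesonClassNumberTwo.lean`, `…ClassGroupFourteen.lean`,
  `…ClassGroupFifteen.lean`, `…ClassNumberTwoUnits.lean`).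

No named fact is introduced (D-0026).

## References

* [KimYamada2023] M. H. Kim, S. Yamada, Kyungpook Math. J. 63 (2023) 373–411 (arXiv:1707.03860):
  §4.2 (Prop. 4.10, 4.11: the traces `49k + 27`), §6.1 (proof of Thm. B).
* [Marcus2018] D. A. Marcus, *Number Fields*, 2nd ed., Ch. 2, Thm. 9 and Exercise 27; Ch. 3,
  Thm. 27 and Exercises 3.20–3.22 (Eisenstein / total ramification and the index).
-/

noncomputable section

open Set Polynomial Module NumberField Ideal
open scoped NumberField nonZeroDivisors
open Literature.NumberTheory.NumberFields

namespace Literature.Topology.FourManifolds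

section Index

variable {K : Type*} [Field K] [NumberField K]

/-- **If `m · 𝓞 K ⊆ ℤ[θ]` then the index determinant divides `m ^ [K : ℚ]`**: with `F` the
`ℤ`-linear endomorphism of `𝓞 K` sending an integral basis to `1, θ, …, θⁿ⁻¹` (`det F` = index
determinant) there is `G` with `F ∘ G = m · id`, so `det F · det G = mⁿ`. [cite: Marcus2018, Ch. 2, Exercise 27(a),(b)] -/
theorem indexDet_dvd_pow_of_smul_mem (B : PowerBasis ℚ K) (hint : IsIntegral ℤ B.gen) (m : ℤ)
    (h : ∀ x : 𝓞 K, m • x ∈ Submodule.span ℤ (Set.range (powInt B hint))) :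
    indexDet B hint ∣ m ^ B.dim := by
  classical
  set b := intBasis B with hb
  let F : 𝓞 K →ₗ[ℤ] 𝓞 K := b.constr ℤ (powInt B hint)
  have hF : ∀ j, F (b j) = powInt B hint j := fun j => by
    simp only [F, Basis.constr_basis]
  have hrange : ∀ x : 𝓞 K, m • x ∈ LinearMap.range F := by
    intro x
    rw [Basis.constr_range]
    exact h x
  choose g hg using fun j => LinearMap.mem_range.mp (hrange (b j))
  let G : 𝓞 K →ₗ[ℤ] 𝓞 K := b.constr ℤ g
  have hFG : F ∘ₗ G = m • LinearMap.id := by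
    refine b.ext fun j => ?_
    simp only [LinearMap.coe_comp, Function.comp_apply, G, Basis.constr_basis, hg,
      LinearMap.smul_apply, LinearMap.id_coe, id_eq]
  have hrank : Module.finrank ℤ (𝓞 K) = B.dim := by
    rw [Module.finrank_eq_card_basis b, Fintype.card_fin]
  have hdet : LinearMap.det F * LinearMap.det G = m ^ B.dim := by
    rw [← LinearMap.det_comp, hFG, LinearMap.det_smul, LinearMap.det_id, mul_one, hrank]
  have hdetF : LinearMap.det F = indexDet B hint := by
    rw [← LinearMap.det_toMatrix b, indexDet, Basis.det_apply]
    congr 1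
    ext i j
    rw [LinearMap.toMatrix_apply, hF, Basis.toMatrix_apply]
  exact ⟨LinearMap.det G, by rw [← hdet, hdetF]⟩

/-- Arithmetic: if `d ∣ m³`, `d² ∣ 49 m`, `7 ∤ m` and `m` is squarefree (bounded check), then
`d = ±1`. [folklore] -/
theorem isUnit_of_dvd_cube_of_sq_dvd {d : ℤ} {m B : ℕ} (hm0 : m ≠ 0) (hA : d ∣ (m : ℤ) ^ 3)
    (hB : d ^ 2 ∣ 49 * (m : ℤ)) (h7 : ¬ 7 ∣ m) (hmB : m < (B + 1) * (B + 1))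
    (hsq : ∀ q ∈ Finset.Icc 2 B, ¬ q * q ∣ m) : IsUnit d := by
  rw [Int.isUnit_iff_natAbs_eq]
  by_contra h1
  obtain ⟨q, hq, hqd⟩ := Nat.exists_prime_and_dvd h1
  have hdm : d.natAbs ∣ m ^ 3 := by
    have h := Int.natAbs_dvd_natAbs.mpr hA
    rwa [Int.natAbs_pow, Int.natAbs_natCast] at h
  have hqm : q ∣ m := hq.dvd_of_dvd_pow (hqd.trans hdm)
  have hq7 : q ≠ 7 := by
    rintro rfl
    exact h7 hqm
  have hd2 : d.natAbs * d.natAbs ∣ 49 * m := by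
    have h := Int.natAbs_dvd_natAbs.mpr hB
    have h49 : (49 * (m : ℤ)).natAbs = 49 * m := by
      rw [Int.natAbs_mul, Int.natAbs_natCast]
      rfl
    rwa [Int.natAbs_pow, pow_two, h49] at h
  have hq2 : q * q ∣ 49 * m := (mul_dvd_mul hqd hqd).trans hd2
  have hcop : Nat.Coprime (q * q) 49 := by
    have h49 : (49 : ℕ) = 7 ^ 2 := by norm_num
    rw [h49, ← pow_two]
    exact Nat.Coprime.pow 2 2 ((Nat.coprime_primes hq (by norm_num)).mpr hq7)
  have hqqm : q * q ∣ m := hcop.dvd_of_dvd_mul_left hq2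
  have hqB : q ≤ B := by
    by_contra hlt
    have hle : (B + 1) * (B + 1) ≤ q * q := Nat.mul_le_mul (by omega) (by omega)
    have := Nat.le_of_dvd (Nat.pos_of_ne_zero hm0) hqqm
    omega
  exact hsq q (Finset.mem_Icc.mpr ⟨hq.two_le, hqB⟩) hqqm

end Index

section Root

variable {K : Type*} [Field K] [NumberField K] {a : ℤ} {θ : K}

/-! ### The shifted cubic `f_a(x + 2)` and the Eisenstein criterion at `7` -/

/-- `f_a = x³ - ax² + (a-1)x - 1` is the generic monic cubic `poly (-a) (a-1) (-1)` of
`CubicFieldExplicit.lean`. [folklore] -/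
theorem csPoly_eq_poly (a : ℤ) : csPoly a = MonicCubic.poly (-a) (a - 1) (-1) := by
  simp only [csPoly, MonicCubic.poly, map_neg, map_sub, map_one]
  ring

omit [NumberField K] in
/-- A root `θ` of `f_a` is a root of `poly (-a) (a-1) (-1)`. [folklore] -/
theorem aeval_poly_of_aeval_csPoly (hθ : aeval θ (csPoly a) = 0) :
    aeval θ (MonicCubic.poly (-a) (a - 1) (-1)) = 0 := by
  rw [← csPoly_eq_poly]; exact hθ

omit [NumberField K] in
/-- `θ - 2` is a root of `f_a(x + 2) = x³ + (6 - a)x² + (11 - 3a)x + (5 - 2a)`. [folklore] -/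
theorem aeval_shift_two (hθ : aeval θ (csPoly a) = 0) :
    aeval (θ - ((2 : ℤ) : K)) (MonicCubic.poly (6 - a) (11 - 3 * a) (5 - 2 * a)) = 0 := by
  have h := hθ
  simp only [csPoly, map_sub, map_add, map_mul, map_pow, aeval_X, map_one, eq_intCast,
    map_intCast] at h
  simp only [MonicCubic.poly, map_add, map_mul, map_pow, aeval_X, eq_intCast, map_intCast]
  push_cast
  linear_combination h

/-- `f_a(x + 2)` is `7`-Eisenstein when `7 ∣ 6 - a, 11 - 3a, 5 - 2a` and `49 ∤ 5 - 2a`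
(i.e. `a ≡ 6 (mod 7)`, `a ≢ 27 (mod 49)`). [cite: KimYamada2023, Prop. 4.10 (f ≡ (x-2)³ mod 7)] -/
theorem isEisensteinAt_shift_two (h6 : (7 : ℤ) ∣ 6 - a) (h11 : (7 : ℤ) ∣ 11 - 3 * a)
    (h5 : (7 : ℤ) ∣ 5 - 2 * a) (h49 : ¬ (7 : ℤ) ^ 2 ∣ 5 - 2 * a) :
    (MonicCubic.poly (6 - a) (11 - 3 * a) (5 - 2 * a)).IsEisensteinAt (Ideal.span {((7 : ℕ) : ℤ)}) :=
  MonicCubic.isEisensteinAt_poly (by norm_num) (by exact_mod_cast h6) (by exact_mod_cast h11)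
    (by exact_mod_cast h5) (by exact_mod_cast h49)

/-- Hence `f_a(x + 2)` is irreducible over `ℚ` (Eisenstein + Gauss). [folklore] -/
theorem irreducible_polyQ_shift_two (h6 : (7 : ℤ) ∣ 6 - a) (h11 : (7 : ℤ) ∣ 11 - 3 * a)
    (h5 : (7 : ℤ) ∣ 5 - 2 * a) (h49 : ¬ (7 : ℤ) ^ 2 ∣ 5 - 2 * a) :
    Irreducible (MonicCubic.polyQ (6 - a) (11 - 3 * a) (5 - 2 * a)) := by
  have hmon := MonicCubic.monic_poly (6 - a) (11 - 3 * a) (5 - 2 * a)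
  have hZ : Irreducible (MonicCubic.poly (6 - a) (11 - 3 * a) (5 - 2 * a)) := by
    refine (isEisensteinAt_shift_two h6 h11 h5 h49).irreducible ?_ hmon.isPrimitive ?_
    · rw [Ideal.span_singleton_prime (by norm_num)]
      exact Int.prime_ofNat_iff.mpr (by norm_num)
    · rw [MonicCubic.natDegree_poly]; norm_num
  rw [MonicCubic.polyQ]
  exact (hmon.irreducible_iff_irreducible_map_fraction_map).mp hZ

/-! ### `𝓞 K = ℤ[θ]` by Eisenstein at `7` -/

/-- **The index of `ℤ[θ]` in `𝓞 K` is `1` for the `7²`-traces** (`Δ(f_a) = 49 m`, `7 ∤ m`,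
`m` squarefree, `f_a(x+2)` Eisenstein at `7`): `Δ · 𝓞 K ⊆ ℤ[θ]`, Eisenstein removes the factor
`7²`, so `m · 𝓞 K ⊆ ℤ[θ]`; then the index determinant `d` has `d ∣ m³` and `d² ∣ Δ = 49 m`, forcing
`d = ±1`. [cite: Marcus2018, Ch. 3, Exercises 3.20–3.22 (Eisenstein and the index)] -/
theorem isUnit_indexDet_csPB_of_eisenstein (hθ : aeval θ (csPoly a) = 0) (h3 : finrank ℚ K = 3)
    {m B : ℕ} (hm0 : m ≠ 0) (hdisc : csDisc a = 49 * m) (h7 : ¬ 7 ∣ m)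
    (hmB : m < (B + 1) * (B + 1)) (hsq : ∀ q ∈ Finset.Icc 2 B, ¬ q * q ∣ m)
    (h6 : (7 : ℤ) ∣ 6 - a) (h11 : (7 : ℤ) ∣ 11 - 3 * a) (h5 : (7 : ℤ) ∣ 5 - 2 * a)
    (h49 : ¬ (7 : ℤ) ^ 2 ∣ 5 - 2 * a) :
    IsUnit (indexDet (csPB hθ h3) (isIntegral_csPB_gen hθ h3)) := by
  set Bp := csPB hθ h3 with hBp
  have hint := isIntegral_csPB_gen hθ h3
  -- (1) `Δ x ∈ ℤ[θ]`
  have hdiscmem : ∀ x : 𝓞 K, ((csDisc a : ℤ) : K) * x ∈ Algebra.adjoin ℤ ({θ} : Set K) := by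
    intro x
    have key := Algebra.discr_mul_isIntegral_mem_adjoin (K := ℚ) (R := ℤ) (B := Bp) hint
      (z := (x : K)) (RingOfIntegers.isIntegral_coe x)
    rw [discr_csPB hθ h3, csPB_gen] at key
    rw [show ((csDisc a : ℤ) : K) * x = (csDisc a : ℚ) • (x : K) by
      rw [Algebra.smul_def, eq_ratCast]; push_cast; rfl]
    exact key
  -- (2) Eisenstein: `m x ∈ ℤ[θ]`
  have hirr' := irreducible_polyQ_shift_two h6 h11 h5 h49
  have hθ' := aeval_shift_two hθ
  have hmmem : ∀ x : 𝓞 K, ((m : K)) * x ∈ Algebra.adjoin ℤ ({θ} : Set K) := by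
    intro x
    have hx : ((7 : ℕ) : K) ^ 2 * (((m : 𝓞 K) * x : 𝓞 K) : K) ∈ Algebra.adjoin ℤ ({θ} : Set K) := by
      have := hdiscmem x
      rw [hdisc] at this
      push_cast at this ⊢
      convert this using 1
      ring
    have := MonicCubic.mem_adjoin_of_eisenstein h3 hirr' hθ' (by norm_num)
      (isEisensteinAt_shift_two h6 h11 h5 h49) hx
    push_cast at this
    exact this
  -- (3) `m • x ∈ span(1, θ, θ²)` in `𝓞 K`
  have hθp := aeval_poly_of_aeval_csPoly hθ
  have hdim : Bp.dim = 3 := csPB_dim hθ h3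
  let j0 : Fin Bp.dim := ⟨0, by omega⟩
  let j1 : Fin Bp.dim := ⟨1, by omega⟩
  let j2 : Fin Bp.dim := ⟨2, by omega⟩
  have hpow : ∀ j : Fin Bp.dim, ((powInt Bp hint j : 𝓞 K) : K) = θ ^ (j : ℕ) := fun j => by
    rw [coe_powInt, Bp.coe_basis, csPB_gen]
  have hspan : ∀ x : 𝓞 K, (m : ℤ) • x ∈ Submodule.span ℤ (Set.range (powInt Bp hint)) := by
    intro x
    obtain ⟨u, v, w, huvw⟩ := MonicCubic.exists_coords_of_mem_adjoin hθp (hmmem x)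
    have heq : (m : ℤ) • x = u • powInt Bp hint j0 + v • powInt Bp hint j1 + w • powInt Bp hint j2 := by
      apply IsFractionRing.injective (𝓞 K) K
      simp only [map_add, zsmul_eq_mul]
      change ((m : ℤ) : K) * (x : K) = (u : K) * ((powInt Bp hint j0 : 𝓞 K) : K) +
        (v : K) * ((powInt Bp hint j1 : 𝓞 K) : K) + (w : K) * ((powInt Bp hint j2 : 𝓞 K) : K)
      rw [hpow, hpow, hpow]
      push_cast
      rw [huvw]
      simp [j0, j1, j2]
    rw [heq]
    refine Submodule.add_mem _ (Submodule.add_mem _ ?_ ?_) ?_ <;>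
      exact Submodule.smul_mem _ _ (Submodule.subset_span ⟨_, rfl⟩)
  -- (4) `d ∣ m³`, `d² ∣ 49 m`
  have hA : indexDet Bp hint ∣ (m : ℤ) ^ 3 := by
    have := indexDet_dvd_pow_of_smul_mem Bp hint m hspan
    rwa [hdim] at this
  have hB : indexDet Bp hint ^ 2 ∣ 49 * (m : ℤ) := by
    have key := discr_powerBasis_eq_indexDet_sq_mul_discr Bp hint
    rw [discr_csPB hθ h3, hdisc] at key
    refine ⟨NumberField.discr K, ?_⟩
    exact_mod_cast key
  exact isUnit_of_dvd_cube_of_sq_dvd hm0 hA hB h7 hmB hsq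

/-! ### Consequences of "the index determinant is a unit" (as for the square-factor hypothesis) -/

/-- `𝓞 K = ℤ[θ]`: every algebraic integer lies in `ℤ[θ]`. [cite: Marcus2018, Ch. 2, Exercise 27(d)] -/
theorem mem_adjoin_theta_of_isUnit (hθ : aeval θ (csPoly a) = 0) (h3 : finrank ℚ K = 3)
    (hu : IsUnit (indexDet (csPB hθ h3) (isIntegral_csPB_gen hθ h3))) (x : 𝓞 K) :
    (x : K) ∈ Algebra.adjoin ℤ ({θ} : Set K) :=
  mem_adjoin_of_isUnit_indexDet (csPB hθ h3) (isIntegral_csPB_gen hθ h3) hu x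

/-- `d_K = Δ(f_a)`. [cite: Marcus2018, Ch. 2, Exercise 27(d)] -/
theorem discr_eq_csDisc_of_isUnit (hθ : aeval θ (csPoly a) = 0) (h3 : finrank ℚ K = 3)
    (hu : IsUnit (indexDet (csPB hθ h3) (isIntegral_csPB_gen hθ h3))) :
    NumberField.discr K = csDisc a :=
  discr_eq_of_isUnit_indexDet (csPB hθ h3) (isIntegral_csPB_gen hθ h3) hu (csDisc a)
    (discr_csPB hθ h3)

/-- `ℤ[θ] = 𝓞 K` inside `𝓞 K`. [cite: Marcus2018, Ch. 2, Exercise 27(d)] -/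
theorem adjoin_thetaInt_eq_top_of_isUnit (hθ : aeval θ (csPoly a) = 0) (h3 : finrank ℚ K = 3)
    (hu : IsUnit (indexDet (csPB hθ h3) (isIntegral_csPB_gen hθ h3))) :
    Algebra.adjoin ℤ ({thetaInt hθ} : Set (𝓞 K)) = ⊤ := by
  refine Algebra.eq_top_iff.mpr fun x => ?_
  have hx := mem_adjoin_theta_of_isUnit hθ h3 hu x
  let φ : 𝓞 K →ₐ[ℤ] K := (algebraMap (𝓞 K) K).toIntAlgHom
  have hmap : Algebra.adjoin ℤ ({θ} : Set K) =
      (Algebra.adjoin ℤ ({thetaInt hθ} : Set (𝓞 K))).map φ := by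
    rw [AlgHom.map_adjoin, Set.image_singleton]
    rfl
  rw [hmap, Subalgebra.mem_map] at hx
  obtain ⟨y, hy, hyx⟩ := hx
  have : y = x := IsFractionRing.injective (𝓞 K) K hyx
  rwa [← this]

/-- Dedekind's criterion applies at every prime: the exponent of `thetaInt hθ` is `1`. [folklore] -/
theorem exponent_thetaInt_of_isUnit (hθ : aeval θ (csPoly a) = 0) (h3 : finrank ℚ K = 3)
    (hu : IsUnit (indexDet (csPB hθ h3) (isIntegral_csPB_gen hθ h3))) :
    RingOfIntegers.exponent (thetaInt hθ) = 1 :=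
  RingOfIntegers.exponent_eq_one_iff.mpr (adjoin_thetaInt_eq_top_of_isUnit hθ h3 hu)

/-- **Dedekind–Kummer for `𝓞 K = ℤ[θ]`** (index a unit). [cite: Marcus2018, Ch. 3, Thm. 27] -/
theorem exists_factor_of_mem_primesOver_of_isUnit (hθ : aeval θ (csPoly a) = 0)
    (h3 : finrank ℚ K = 3) (hu : IsUnit (indexDet (csPB hθ h3) (isIntegral_csPB_gen hθ h3)))
    {p : ℕ} (hp : p.Prime) {P : Ideal (𝓞 K)} (hP : P ∈ primesOver (span {(p : ℤ)}) (𝓞 K)) :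
    ∃ Qb : (ZMod p)[X], Irreducible Qb ∧ Qb.Monic ∧ Qb ∣ csPolyMod a p ∧
      P.inertiaDeg ℤ = Qb.natDegree ∧
      ∀ Q : ℤ[X], Q.map (Int.castRingHom (ZMod p)) = Qb →
        P = span {(p : 𝓞 K), aeval (thetaInt hθ) Q} := by
  haveI := Fact.mk hp
  have hexp : ¬ p ∣ RingOfIntegers.exponent (thetaInt hθ) := by
    rw [exponent_thetaInt_of_isUnit hθ h3 hu, Nat.dvd_one]
    exact hp.ne_one
  set e := NumberField.Ideal.primesOverSpanEquivMonicFactorsMod (K := K) hexp with he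
  set Qb := e ⟨P, hP⟩ with hQb
  have hmem : (Qb : (ZMod p)[X]) ∈ RingOfIntegers.monicFactorsMod (thetaInt hθ) p := Qb.2
  have hmem' := hmem
  simp only [RingOfIntegers.monicFactorsMod, Multiset.mem_toFinset, minpoly_thetaInt hθ] at hmem'
  have h0 : csPolyMod a p ≠ 0 := (monic_csPolyMod a p).ne_zero
  obtain ⟨hirr, hmon, hdvd⟩ := (Polynomial.mem_normalizedFactors_iff h0).mp hmem'
  refine ⟨Qb, hirr, hmon, hdvd, ?_, ?_⟩
  · have := NumberField.Ideal.inertiaDeg_primesOverSpanEquivMonicFactorsMod_symm_apply' hexp hmem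
    rwa [show (⟨(Qb : (ZMod p)[X]), hmem⟩ : RingOfIntegers.monicFactorsMod (thetaInt hθ) p) = Qb
      from Subtype.ext rfl, Equiv.symm_apply_apply] at this
  · intro Q hQ
    have hmemQ : Q.map (Int.castRingHom (ZMod p)) ∈
        RingOfIntegers.monicFactorsMod (thetaInt hθ) p := hQ ▸ hmem
    have h1 := NumberField.Ideal.primesOverSpanEquivMonicFactorsMod_symm_apply_eq_span hexp hmemQ
    have h2 : (⟨Q.map (Int.castRingHom (ZMod p)), hmemQ⟩ :
        RingOfIntegers.monicFactorsMod (thetaInt hθ) p) = Qb := Subtype.ext hQ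
    rw [h2, hQb, Equiv.symm_apply_apply] at h1
    exact h1

/-- **Inert primes** (index a unit). [cite: Marcus2018, Ch. 3, Thm. 27] -/
theorem eq_span_of_no_root_of_isUnit (hθ : aeval θ (csPoly a) = 0) (h3 : finrank ℚ K = 3)
    (hu : IsUnit (indexDet (csPB hθ h3) (isIntegral_csPB_gen hθ h3))) {p : ℕ} (hp : p.Prime)
    {P : Ideal (𝓞 K)} (hP : P ∈ primesOver (span {(p : ℤ)}) (𝓞 K))
    (hnr : ∀ c : ZMod p, c ^ 3 - (a : ZMod p) * c ^ 2 + ((a : ZMod p) - 1) * c - 1 ≠ 0) :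
    P = span {(p : 𝓞 K)} := by
  haveI := Fact.mk hp
  obtain ⟨Qb, hirr, hmon, hdvd, -, hspan⟩ := exists_factor_of_mem_primesOver_of_isUnit hθ h3 hu hp hP
  have hfirr : Irreducible (csPolyMod a p) := by
    refine irreducible_of_degree_le_three_of_not_isRoot
      (by rw [natDegree_csPolyMod]; decide) fun c hc => hnr c ?_
    rwa [IsRoot.def, eval_csPolyMod] at hc
  have hQb : Qb = csPolyMod a p :=
    eq_of_monic_of_associated hmon (monic_csPolyMod a p) (hirr.associated_of_dvd hfirr hdvd)
  have h := hspan (csPoly a) (by rw [hQb]; rfl)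
  rw [aeval_thetaInt hθ] at h
  rw [h, Ideal.span_insert, Ideal.span_singleton_eq_bot.mpr rfl, sup_bot_eq]

/-- **Degree-one primes above a prime with a single simple root** (index a unit). [cite: Marcus2018, Ch. 3, Thm. 27] -/
theorem eq_span_pair_of_unique_root_of_isUnit (hθ : aeval θ (csPoly a) = 0) (h3 : finrank ℚ K = 3)
    (hu : IsUnit (indexDet (csPB hθ h3) (isIntegral_csPB_gen hθ h3))) {p : ℕ} (hp : p.Prime)
    {P : Ideal (𝓞 K)} (hP : P ∈ primesOver (span {(p : ℤ)}) (𝓞 K)) {U : ℕ}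
    (hle : p ^ P.inertiaDeg ℤ ≤ U) {c₀ : ℤ}
    (hroot : ∀ c : ZMod p, c ^ 3 - (a : ZMod p) * c ^ 2 + ((a : ZMod p) - 1) * c - 1 = 0 →
      c = (c₀ : ZMod p))
    (hU : U < p ^ 2) :
    P = span {(p : 𝓞 K), thetaInt hθ - (c₀ : 𝓞 K)} := by
  haveI := Fact.mk hp
  obtain ⟨Qb, hirr, hmon, hdvd, hdeg, hspan⟩ :=
    exists_factor_of_mem_primesOver_of_isUnit hθ h3 hu hp hP
  have hQb1 : Qb.natDegree = 1 := by
    have h1 : 1 ≤ Qb.natDegree := by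
      rcases Nat.eq_zero_or_pos Qb.natDegree with h0 | h0
      · exact absurd (Polynomial.eq_one_of_monic_natDegree_zero hmon h0 ▸ isUnit_one)
          hirr.not_isUnit
      · exact h0
    by_contra hne
    have h2 : 2 ≤ Qb.natDegree := by omega
    have : p ^ 2 ≤ p ^ P.inertiaDeg ℤ := Nat.pow_le_pow_right hp.pos (hdeg ▸ h2)
    omega
  have hQbeq : Qb = X + C (Qb.coeff 0) := hmon.eq_X_add_C hQb1
  have hc : -Qb.coeff 0 = (c₀ : ZMod p) := by
    apply hroot
    have hr : (csPolyMod a p).IsRoot (-Qb.coeff 0) := by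
      rw [← dvd_iff_isRoot, map_neg, sub_neg_eq_add, ← hQbeq]
      exact hdvd
    rwa [IsRoot.def, eval_csPolyMod] at hr
  have hQb' : (X - C c₀ : ℤ[X]).map (Int.castRingHom (ZMod p)) = Qb := by
    rw [Polynomial.map_sub, map_X, map_C, eq_intCast, ← hc, map_neg, sub_neg_eq_add, ← hQbeq]
  have hPeq := hspan (X - C c₀) hQb'
  simp only [map_sub, aeval_X, aeval_C, algebraMap_int_eq, Int.coe_castRingHom] at hPeq
  exact hPeq

/-- **Primes above a prime at which `f_a` is a product of linear factors** (index a unit; the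
roots need not be distinct). [cite: Marcus2018, Ch. 3, Thm. 27] -/
theorem eq_span_pair_of_split_of_isUnit (hθ : aeval θ (csPoly a) = 0) (h3 : finrank ℚ K = 3)
    (hu : IsUnit (indexDet (csPB hθ h3) (isIntegral_csPB_gen hθ h3))) {p : ℕ} (hp : p.Prime)
    {c₁ c₂ c₃ : ℤ}
    (hfac : csPolyMod a p = (X - C (c₁ : ZMod p)) * (X - C (c₂ : ZMod p)) * (X - C (c₃ : ZMod p)))
    {P : Ideal (𝓞 K)} (hP : P ∈ primesOver (span {(p : ℤ)}) (𝓞 K)) :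
    P = span {(p : 𝓞 K), thetaInt hθ - (c₁ : 𝓞 K)} ∨ P = span {(p : 𝓞 K), thetaInt hθ - (c₂ : 𝓞 K)} ∨
      P = span {(p : 𝓞 K), thetaInt hθ - (c₃ : 𝓞 K)} := by
  haveI := Fact.mk hp
  obtain ⟨Qb, hirr, hmon, hdvd, -, hspan⟩ := exists_factor_of_mem_primesOver_of_isUnit hθ h3 hu hp hP
  rw [hfac] at hdvd
  have hlin : ∀ c : ℤ, Qb = X - C (c : ZMod p) → P = span {(p : 𝓞 K), thetaInt hθ - (c : 𝓞 K)} := by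
    intro c hc
    have hQb' : (X - C c : ℤ[X]).map (Int.castRingHom (ZMod p)) = Qb := by
      rw [Polynomial.map_sub, map_X, map_C, eq_intCast, hc]
    have hPeq := hspan (X - C c) hQb'
    simp only [map_sub, aeval_X, aeval_C, algebraMap_int_eq, Int.coe_castRingHom] at hPeq
    exact hPeq
  rcases eq_of_irreducible_of_dvd_linear_mul hirr hmon hdvd with h1 | h2 | h3'
  · exact Or.inl (hlin _ h1)
  · exact Or.inr (Or.inl (hlin _ h2))
  · exact Or.inr (Or.inr (hlin _ h3'))

/-- **Primes above `p` when `f_a ≡ (x - c) g (mod p)` with `g` an irreducible quadratic** (index a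
unit). [cite: Marcus2018, Ch. 3, Thm. 27] -/
theorem eq_span_pair_of_linear_mul_quadratic_of_isUnit (hθ : aeval θ (csPoly a) = 0)
    (h3 : finrank ℚ K = 3) (hu : IsUnit (indexDet (csPB hθ h3) (isIntegral_csPB_gen hθ h3)))
    {p : ℕ} (hp : p.Prime) {c : ℤ} {G : ℤ[X]}
    (hGmon : (G.map (Int.castRingHom (ZMod p))).Monic)
    (hGirr : Irreducible (G.map (Int.castRingHom (ZMod p))))
    (hfac : csPolyMod a p = (X - C (c : ZMod p)) * G.map (Int.castRingHom (ZMod p)))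
    {P : Ideal (𝓞 K)} (hP : P ∈ primesOver (span {(p : ℤ)}) (𝓞 K)) :
    P = span {(p : 𝓞 K), thetaInt hθ - (c : 𝓞 K)} ∨
      P = span {(p : 𝓞 K), aeval (thetaInt hθ) G} := by
  haveI := Fact.mk hp
  obtain ⟨Qb, hirr, hmon, hdvd, -, hspan⟩ := exists_factor_of_mem_primesOver_of_isUnit hθ h3 hu hp hP
  rw [hfac] at hdvd
  rcases hirr.prime.dvd_or_dvd hdvd with hlin | hquad
  · left
    have hdeg1 : 1 ≤ Qb.natDegree := by
      rcases Nat.eq_zero_or_pos Qb.natDegree with h0 | h0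
      · exact absurd (Polynomial.eq_one_of_monic_natDegree_zero hmon h0 ▸ isUnit_one) hirr.not_isUnit
      · exact h0
    have hQc : Qb = X - C (c : ZMod p) :=
      (Polynomial.eq_of_monic_of_dvd_of_natDegree_le hmon (monic_X_sub_C _) hlin
        (by rw [natDegree_X_sub_C]; exact hdeg1)).symm
    have hQb' : (X - C c : ℤ[X]).map (Int.castRingHom (ZMod p)) = Qb := by
      rw [Polynomial.map_sub, map_X, map_C, eq_intCast, hQc]
    have hPeq := hspan (X - C c) hQb'
    simp only [map_sub, aeval_X, aeval_C, algebraMap_int_eq, Int.coe_castRingHom] at hPeq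
    exact hPeq
  · right
    have hQG : Qb = G.map (Int.castRingHom (ZMod p)) :=
      eq_of_monic_of_associated hmon hGmon (hirr.associated_of_dvd hGirr hquad)
    exact hspan G hQG.symm

/-- **`ℤ[X]/(f_a) ≅ 𝓞 K = ℤ[θ]`** (index a unit), the root going to `θ`. [cite: Marcus2018, Ch. 2, Exercise 27(d)] -/
theorem exists_ringEquiv_adjoinRoot_of_isUnit (hθ : aeval θ (csPoly a) = 0) (h3 : finrank ℚ K = 3)
    (hu : IsUnit (indexDet (csPB hθ h3) (isIntegral_csPB_gen hθ h3))) :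
    ∃ e : AdjoinRoot (csPoly a) ≃+* 𝓞 K, e (AdjoinRoot.root (csPoly a)) = thetaInt hθ := by
  have htop := adjoin_thetaInt_eq_top_of_isUnit hθ h3 hu
  have key : ∀ g : ℤ[X], g = minpoly ℤ (thetaInt hθ) →
      ∃ e : AdjoinRoot g ≃+* 𝓞 K, e (AdjoinRoot.root g) = thetaInt hθ := by
    intro g hg
    subst hg
    have hint : IsIntegral ℤ (thetaInt hθ) := Algebra.IsIntegral.isIntegral _
    let e₁ := minpoly.equivAdjoin hint
    let e₂ : Algebra.adjoin ℤ ({thetaInt hθ} : Set (𝓞 K)) ≃ₐ[ℤ] 𝓞 K :=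
      (Subalgebra.equivOfEq _ _ htop).trans Subalgebra.topEquiv
    refine ⟨(e₁.trans e₂).toRingEquiv, ?_⟩
    have h1 : ((e₁ (AdjoinRoot.root _) : Algebra.adjoin ℤ ({thetaInt hθ} : Set (𝓞 K))) : 𝓞 K) =
        thetaInt hθ := by
      change ((minpoly.equivAdjoin hint (AdjoinRoot.mk _ X) : Algebra.adjoin ℤ _) : 𝓞 K) = _
      rw [minpoly.coe_equivAdjoin]
      exact AdjoinRoot.Minpoly.coe_toAdjoin_mk_X
    have h2 : ∀ y, e₂ y = (y : 𝓞 K) := fun y => rfl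
    calc (e₁.trans e₂).toRingEquiv (AdjoinRoot.root _) = e₂ (e₁ (AdjoinRoot.root _)) := rfl
      _ = ((e₁ (AdjoinRoot.root _) : Algebra.adjoin ℤ ({thetaInt hθ} : Set (𝓞 K))) : 𝓞 K) := h2 _
      _ = thetaInt hθ := h1
  exact key _ (minpoly_thetaInt hθ).symm

end Root

end Literature.Topology.FourManifolds
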